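import Summits.CriticalPhenomena.CardyFormulaZ2.Theorems.CardyIKTransportIKLinearTransportStubCutMarkovKernelAbstract

/-!
# Stub `stub_CutMarkovKernel` (K) — part B: HALF-STRIP REACHABILITY and three graph lemmas

Support file (`--supports stmt-CriticalPhenomena-5076`, registered sub-goal `cmk_excursion`).

Vocabulary and graph lemmas for the factorisation of the strip diagram across a cut row:

* `cmkRW i lo hi x` — pairs of strip cells of one colour joined by a monochromatic strip path inside the
  rows `[lo, hi]` (the window diagram `SDE.DgW` without its restriction to boundary endpoints); it reads
  only the window (`cmkRW_congr_obs`) and its events are measurable (`measurableSet_cmkRW_obs`);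
* `cmkUpR i c x` / `cmkLoR i c x` — pairs joined inside the half-strips of rows `≥ c` / `≤ c`
  (countable unions of `cmkRW`), characterised through `SDE.within`-reachability
  (`cmk_mem_UpR_iff`, `cmk_mem_LoR_iff`), measurable;
* `cmk_reach_congr_of_bichromatic` — flipping the flags of faces whose two diagonals are BICHROMATIC for a
  vertex set does not change reachability inside that set (the restricted graphs coincide);
* `cmk_exists_row_split` — a path from row `≤ y` to row `≥ y` visits row `y` at a vertex joined to both ends;
* `cmk_excursion` (registered) — THE EXCURSION LEMMA: a path between two DISTINCT row-`c` vertices contains a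
  one-sided sub-path (inside the rows `≥ c` or inside the rows `≤ c`) from its start to another row-`c`
  vertex. With the separation at a cut row this is the converse of rerouting: it recovers
  `((i,c),(i+2,c)) ∉ stripDiagram` from the two half-strips.
-/

noncomputable section

namespace Summit.CriticalPhenomena.CardyFormulaZ2.Theorems.IKLinearTransport.PinnedDiagramExchange

open scoped Classical MeasureTheory ENNReal symmDiff
open Set MeasureTheory
open Literature.Probability.Percolation Literature.Probability.LatticeModels

/-! ## Window reachability between arbitrary strip cells -/

/-- Pairs of strip cells of one colour joined by a monochromatic strip path inside the rows `[lo, hi]`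
(`SDE.DgW` without the boundary restriction on the endpoints). [folklore] -/
def cmkRW (i lo hi : ℤ) (x : Obs) : Set (Site 2 × Site 2) :=
  {pq | pq.2 ∈ SDE.clsW x i lo hi pq.1 ∧ pq.1 ∈ SDE.clsW x i lo hi pq.1 ∧
    (SDE.within (cellGraph x.2) (SDE.clsW x i lo hi pq.1)).Reachable pq.1 pq.2}

/-- The window diagram is the boundary part of the window reachability. [folklore] -/
theorem cmk_mem_DgW_iff (i lo hi : ℤ) (x : Obs) (pq : Site 2 × Site 2) :
    pq ∈ SDE.DgW i lo hi x ↔ (pq.1 0 = i ∨ pq.1 0 = i + 2) ∧ (pq.2 0 = i ∨ pq.2 0 = i + 2) ∧ pq ∈ cmkRW i lo hi x :=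
  Iff.rfl

/-- Window reachability only reads the window. [folklore] -/
theorem cmkRW_congr_obs (i lo hi : ℤ) {x x' : Obs}
    (h1 : ∀ v : Site 2, i ≤ v 0 → v 0 ≤ i + 2 → lo ≤ v 1 → v 1 ≤ hi → (v ∈ x.1 ↔ v ∈ x'.1))
    (h2 : ∀ f : Site 2, (f 0 = i ∨ f 0 = i + 1) → lo ≤ f 1 → f 1 < hi → (f ∈ x.2 ↔ f ∈ x'.2)) :
    cmkRW i lo hi x ⊆ cmkRW i lo hi x' := by
  rintro ⟨p, q⟩ ⟨⟨⟨hqc, hq0, hq0'⟩, hq1, hq1'⟩, ⟨⟨-, hp0, hp0'⟩, hp1, hp1'⟩, hr⟩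
  have hpc : p ∈ x.1 ↔ p ∈ x'.1 := h1 p hp0 hp0' hp1 hp1'
  have hset : SDE.clsW x i lo hi p ⊆ SDE.clsW x' i lo hi p := fun v ⟨⟨hv, hv0, hv0'⟩, hv1, hv1'⟩ =>
    ⟨⟨by rw [← h1 v hv0 hv0' hv1 hv1', ← hpc]; exact hv, hv0, hv0'⟩, hv1, hv1'⟩
  refine ⟨⟨⟨by rw [← h1 q hq0 hq0' hq1 hq1', ← hpc]; exact hqc, hq0, hq0'⟩, hq1, hq1'⟩,
    ⟨⟨Iff.rfl, hp0, hp0'⟩, hp1, hp1'⟩, SDE.within_mono _ hset (SDE.within_mono_graph _ (fun u v hu hv huv => ?_) hr)⟩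
  rw [SDE.cellGraph_adj_iff] at huv ⊢
  refine (SDE.grid_adj_map _ _ 0 0 (u 0, u 1) (v 0, v 1) (fun c d hc hd => ?_)).1 huv |> fun e => by simpa using e
  simp only at hc hd
  rw [add_zero, add_zero]
  have := hu.1.2.1; have := hu.1.2.2; have := hv.1.2.1; have := hv.1.2.2
  have := hu.2.1; have := hu.2.2; have := hv.2.1; have := hv.2.2
  exact h2 _ (by simp; omega) (by simp; omega) (by simp; omega)

/-- Window-reachability events of observables are measurable. [folklore] -/
theorem measurableSet_cmkRW_obs (i lo hi : ℤ) (pq : Site 2 × Site 2) : MeasurableSet {x : Obs | pq ∈ cmkRW i lo hi x} := by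
  let C : Set (Site 2) := {v | i ≤ v 0 ∧ v 0 ≤ i + 2 ∧ lo ≤ v 1 ∧ v 1 ≤ hi}
  let Fc : Set (Site 2) := {f | (f 0 = i ∨ f 0 = i + 1) ∧ lo ≤ f 1 ∧ f 1 < hi}
  have hbox : ∀ (D : Set (Site 2)) (a b c d : ℤ), (∀ v ∈ D, a ≤ v 0 ∧ v 0 ≤ b ∧ c ≤ v 1 ∧ v 1 ≤ d) → D.Finite := by
    intro D a b c d hD
    refine (((Set.finite_Icc a b).prod (Set.finite_Icc c d)).image fun ab : ℤ × ℤ => (![ab.1, ab.2] : Site 2)).subset ?_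
    intro v hv
    obtain ⟨h1, h2, h3, h4⟩ := hD v hv
    exact ⟨(v 0, v 1), ⟨⟨h1, h2⟩, h3, h4⟩, SDE.site2_eta v⟩
  have hC : C.Finite := hbox C i (i + 2) lo hi fun v hv => hv
  have hF : Fc.Finite := hbox Fc i (i + 1) lo hi fun v hv => ⟨by rcases hv.1 with e | e <;> omega, by rcases hv.1 with e | e <;> omega,
    hv.2.1, by have := hv.2.2; omega⟩
  haveI : Finite ↥C := hC.to_subtype
  haveI : Finite ↥Fc := hF.to_subtype
  have hρ : Measurable (fun x : Obs => ((fun v : ↥C => (v : Site 2) ∈ x.1), (fun f : ↥Fc => (f : Site 2) ∈ x.2))) :=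
    (measurable_pi_lambda (fun (x : Obs) (v : ↥C) => (v : Site 2) ∈ x.1)
      fun v => (measurable_set_mem (v : Site 2)).comp measurable_fst).prodMk
      (measurable_pi_lambda (fun (x : Obs) (f : ↥Fc) => (f : Site 2) ∈ x.2)
        fun f => (measurable_set_mem (f : Site 2)).comp measurable_snd)
  have hE : {x : Obs | pq ∈ cmkRW i lo hi x} = (fun x : Obs => ((fun v : ↥C => (v : Site 2) ∈ x.1), (fun f : ↥Fc => (f : Site 2) ∈ x.2))) ⁻¹'
      ((fun x : Obs => ((fun v : ↥C => (v : Site 2) ∈ x.1), (fun f : ↥Fc => (f : Site 2) ∈ x.2))) '' {x : Obs | pq ∈ cmkRW i lo hi x}) := by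
    ext x
    constructor
    · intro hx; exact ⟨x, hx, rfl⟩
    · rintro ⟨x', hx', he⟩
      have h1 : ∀ v : Site 2, i ≤ v 0 → v 0 ≤ i + 2 → lo ≤ v 1 → v 1 ≤ hi → (v ∈ x'.1 ↔ v ∈ x.1) := fun v a b c d => by
        have := congrFun (Prod.ext_iff.1 he).1 ⟨v, a, b, c, d⟩; exact Iff.of_eq this
      have h2 : ∀ f : Site 2, (f 0 = i ∨ f 0 = i + 1) → lo ≤ f 1 → f 1 < hi → (f ∈ x'.2 ↔ f ∈ x.2) := fun f a b c => by
        have := congrFun (Prod.ext_iff.1 he).2 ⟨f, a, b, c⟩; exact Iff.of_eq this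
      exact cmkRW_congr_obs i lo hi h1 h2 hx'
  rw [hE]
  exact (Set.toFinite _).measurableSet.preimage hρ

/-! ## Half-strip reachability -/

/-- Pairs of strip cells joined by a monochromatic strip path inside the rows `≥ c`. [folklore] -/
def cmkUpR (i c : ℤ) (x : Obs) : Set (Site 2 × Site 2) := {pq | ∃ m : ℕ, pq ∈ cmkRW i c (c + m) x}

/-- Pairs of strip cells joined by a monochromatic strip path inside the rows `≤ c`. [folklore] -/
def cmkLoR (i c : ℤ) (x : Obs) : Set (Site 2 × Site 2) := {pq | ∃ m : ℕ, pq ∈ cmkRW i (c - m) c x}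

/-- The strip set of `…Reroute.lean` is the colour class of `SDE`. [folklore] -/
theorem crkStrip_eq_cls (i : ℤ) (x : Obs) (p : Site 2) : crkStrip i x (p ∈ x.1) = SDE.cls x i p := rfl

/-- Half-strip reachability events are measurable. [folklore] -/
theorem measurableSet_cmkUpR_obs (i c : ℤ) (pq : Site 2 × Site 2) : MeasurableSet {x : Obs | pq ∈ cmkUpR i c x} := by
  have : {x : Obs | pq ∈ cmkUpR i c x} = ⋃ m : ℕ, {x | pq ∈ cmkRW i c (c + m) x} := by
    ext x; simp only [cmkUpR, mem_setOf_eq, mem_iUnion]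
  rw [this]; exact MeasurableSet.iUnion fun m => measurableSet_cmkRW_obs i _ _ pq

/-- Half-strip reachability events are measurable (lower side). [folklore] -/
theorem measurableSet_cmkLoR_obs (i c : ℤ) (pq : Site 2 × Site 2) : MeasurableSet {x : Obs | pq ∈ cmkLoR i c x} := by
  have : {x : Obs | pq ∈ cmkLoR i c x} = ⋃ m : ℕ, {x | pq ∈ cmkRW i (c - m) c x} := by
    ext x; simp only [cmkLoR, mem_setOf_eq, mem_iUnion]
  rw [this]; exact MeasurableSet.iUnion fun m => measurableSet_cmkRW_obs i _ _ pq

/-- UPPER HALF-STRIP REACHABILITY through `within`: a path inside the rows `≥ c` lies in a finite window. [folklore] -/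
theorem cmk_mem_UpR_iff (i c : ℤ) (x : Obs) (p q : Site 2) :
    (p, q) ∈ cmkUpR i c x ↔ (q ∈ SDE.cls x i p ∧ c ≤ q 1) ∧ (p ∈ SDE.cls x i p ∧ c ≤ p 1) ∧
      (SDE.within (cellGraph x.2) (SDE.cls x i p ∩ {v | c ≤ v 1})).Reachable p q := by
  constructor
  · rintro ⟨m, ⟨hq, hq1, -⟩, ⟨hp, hp1, -⟩, hr⟩
    have hsub : SDE.clsW x i c (c + m) p ⊆ SDE.cls x i p ∩ {v | c ≤ v 1} := fun v hv => ⟨hv.1, hv.2.1⟩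
    exact ⟨⟨hq, hq1⟩, ⟨hp, hp1⟩, SDE.within_mono _ hsub hr⟩
  · rintro ⟨⟨hq, hq1⟩, ⟨hp, hp1⟩, hr⟩
    have key : ∀ {v : Site 2}, Relation.ReflTransGen (SDE.within (cellGraph x.2) (SDE.cls x i p ∩ {v | c ≤ v 1})).Adj p v →
        ∃ m : ℕ, p 1 ≤ c + m ∧ v 1 ≤ c + m ∧ (SDE.within (cellGraph x.2) (SDE.clsW x i c (c + m) p)).Reachable p v := by
      intro v h
      induction h with
      | refl => exact ⟨(p 1 - c).toNat, by omega, by omega, SimpleGraph.Reachable.refl _⟩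
      | @tail b' d _ hbd ih =>
        obtain ⟨m, h1, h2, h3⟩ := ih
        refine ⟨max m (d 1 - c).toNat, by omega, by omega, ?_⟩
        have hsub : SDE.clsW x i c (c + m) p ⊆ SDE.clsW x i c (c + (max m (d 1 - c).toNat : ℕ)) p :=
          fun w hw => ⟨hw.1, hw.2.1, by have := hw.2.2; omega⟩
        have hpw : p ∈ SDE.clsW x i c (c + m) p := ⟨hp, hp1, by omega⟩
        have hbm : b' ∈ SDE.clsW x i c (c + m) p := SDE.within_reachable_mem _ _ h3 hpw
        have hb' : b' ∈ SDE.clsW x i c (c + (max m (d 1 - c).toNat : ℕ)) p :=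
          ⟨hbd.2.1.1, hbd.2.1.2, by have := hbm.2.2; omega⟩
        have hd' : d ∈ SDE.clsW x i c (c + (max m (d 1 - c).toNat : ℕ)) p :=
          ⟨hbd.2.2.1, hbd.2.2.2, by have := hbd.2.2.2; show d 1 ≤ _; omega⟩
        exact (SDE.within_mono _ hsub h3).trans (SimpleGraph.Adj.reachable ⟨hbd.1, hb', hd'⟩)
    obtain ⟨m, h1, h2, h3⟩ := key ((SimpleGraph.reachable_iff_reflTransGen _ _).1 hr)
    exact ⟨m, ⟨hq, hq1, h2⟩, ⟨hp, hp1, h1⟩, h3⟩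

/-- LOWER HALF-STRIP REACHABILITY through `within`. [folklore] -/
theorem cmk_mem_LoR_iff (i c : ℤ) (x : Obs) (p q : Site 2) :
    (p, q) ∈ cmkLoR i c x ↔ (q ∈ SDE.cls x i p ∧ q 1 ≤ c) ∧ (p ∈ SDE.cls x i p ∧ p 1 ≤ c) ∧
      (SDE.within (cellGraph x.2) (SDE.cls x i p ∩ {v | v 1 ≤ c})).Reachable p q := by
  constructor
  · rintro ⟨m, ⟨hq, -, hq1⟩, ⟨hp, -, hp1⟩, hr⟩
    have hsub : SDE.clsW x i (c - m) c p ⊆ SDE.cls x i p ∩ {v | v 1 ≤ c} := fun v hv => ⟨hv.1, hv.2.2⟩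
    exact ⟨⟨hq, hq1⟩, ⟨hp, hp1⟩, SDE.within_mono _ hsub hr⟩
  · rintro ⟨⟨hq, hq1⟩, ⟨hp, hp1⟩, hr⟩
    have key : ∀ {v : Site 2}, Relation.ReflTransGen (SDE.within (cellGraph x.2) (SDE.cls x i p ∩ {v | v 1 ≤ c})).Adj p v →
        ∃ m : ℕ, c - m ≤ p 1 ∧ c - m ≤ v 1 ∧ (SDE.within (cellGraph x.2) (SDE.clsW x i (c - m) c p)).Reachable p v := by
      intro v h
      induction h with
      | refl => exact ⟨(c - p 1).toNat, by omega, by omega, SimpleGraph.Reachable.refl _⟩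
      | @tail b' d _ hbd ih =>
        obtain ⟨m, h1, h2, h3⟩ := ih
        refine ⟨max m (c - d 1).toNat, by omega, by omega, ?_⟩
        have hsub : SDE.clsW x i (c - m) c p ⊆ SDE.clsW x i (c - (max m (c - d 1).toNat : ℕ)) c p :=
          fun w hw => ⟨hw.1, by have := hw.2.1; omega, hw.2.2⟩
        have hpw : p ∈ SDE.clsW x i (c - m) c p := ⟨hp, by omega, hp1⟩
        have hbm : b' ∈ SDE.clsW x i (c - m) c p := SDE.within_reachable_mem _ _ h3 hpw
        have hb' : b' ∈ SDE.clsW x i (c - (max m (c - d 1).toNat : ℕ)) c p :=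
          ⟨hbd.2.1.1, by have := hbm.2.1; omega, hbd.2.1.2⟩
        have hd' : d ∈ SDE.clsW x i (c - (max m (c - d 1).toNat : ℕ)) c p :=
          ⟨hbd.2.2.1, by show _ ≤ d 1; omega, hbd.2.2.2⟩
        exact (SDE.within_mono _ hsub h3).trans (SimpleGraph.Adj.reachable ⟨hbd.1, hb', hd'⟩)
    obtain ⟨m, h1, h2, h3⟩ := key ((SimpleGraph.reachable_iff_reflTransGen _ _).1 hr)
    exact ⟨m, ⟨hq, h2, hq1⟩, ⟨hp, h1, hp1⟩, h3⟩

/-- Cells of one colour class have the same colour class. [folklore] -/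
theorem cmk_cls_eq_of_mem {i : ℤ} {x : Obs} {p q : Site 2} (h : q ∈ SDE.cls x i p) : SDE.cls x i q = SDE.cls x i p := by
  ext v; simp only [SDE.cls, mem_setOf_eq, h.1]

/-- Upper half-strip reachability is symmetric. [folklore] -/
theorem cmk_UpR_symm {i c : ℤ} {x : Obs} {p q : Site 2} (h : (p, q) ∈ cmkUpR i c x) : (q, p) ∈ cmkUpR i c x := by
  rw [cmk_mem_UpR_iff] at h ⊢
  obtain ⟨⟨hq, hq1⟩, ⟨hp, hp1⟩, hr⟩ := h
  have e := cmk_cls_eq_of_mem hq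
  refine ⟨⟨by rw [e]; exact hp, hp1⟩, ⟨⟨Iff.rfl, hq.2⟩, hq1⟩, ?_⟩
  rw [e]; exact hr.symm

/-- Lower half-strip reachability is symmetric. [folklore] -/
theorem cmk_LoR_symm {i c : ℤ} {x : Obs} {p q : Site 2} (h : (p, q) ∈ cmkLoR i c x) : (q, p) ∈ cmkLoR i c x := by
  rw [cmk_mem_LoR_iff] at h ⊢
  obtain ⟨⟨hq, hq1⟩, ⟨hp, hp1⟩, hr⟩ := h
  have e := cmk_cls_eq_of_mem hq
  refine ⟨⟨by rw [e]; exact hp, hp1⟩, ⟨⟨Iff.rfl, hq.2⟩, hq1⟩, ?_⟩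
  rw [e]; exact hr.symm

/-- Half-strip reachability is transitive (upper). [folklore] -/
theorem cmk_UpR_trans {i c : ℤ} {x : Obs} {p q r : Site 2} (h : (p, q) ∈ cmkUpR i c x) (h' : (q, r) ∈ cmkUpR i c x) :
    (p, r) ∈ cmkUpR i c x := by
  rw [cmk_mem_UpR_iff] at h h' ⊢
  obtain ⟨⟨hq, hq1⟩, hp, hr⟩ := h
  obtain ⟨⟨hr', hr1⟩, -, hr''⟩ := h'
  have e := cmk_cls_eq_of_mem hq
  rw [e] at hr' hr''
  exact ⟨⟨hr', hr1⟩, hp, hr.trans hr''⟩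

/-- Half-strip reachability is transitive (lower). [folklore] -/
theorem cmk_LoR_trans {i c : ℤ} {x : Obs} {p q r : Site 2} (h : (p, q) ∈ cmkLoR i c x) (h' : (q, r) ∈ cmkLoR i c x) :
    (p, r) ∈ cmkLoR i c x := by
  rw [cmk_mem_LoR_iff] at h h' ⊢
  obtain ⟨⟨hq, hq1⟩, hp, hr⟩ := h
  obtain ⟨⟨hr', hr1⟩, -, hr''⟩ := h'
  have e := cmk_cls_eq_of_mem hq
  rw [e] at hr' hr''
  exact ⟨⟨hr', hr1⟩, hp, hr.trans hr''⟩

/-- Strip-diagram membership from reachability inside a part of a colour class. [folklore] -/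
theorem cmk_mem_stripDiagram_of_within {i : ℤ} {x : Obs} {p q : Site 2} (hp0 : p 0 = i ∨ p 0 = i + 2)
    (hq0 : q 0 = i ∨ q 0 = i + 2) (hq : q ∈ SDE.cls x i p) {t : Set (Site 2)} (ht : t ⊆ SDE.cls x i p)
    (h : (SDE.within (cellGraph x.2) t).Reachable p q) : (p, q) ∈ stripDiagram i x := by
  rw [SDE.mem_stripDiagram_iff]
  exact ⟨hp0, hq0, hq, ⟨Iff.rfl, by rcases hp0 with e | e <;> omega, by rcases hp0 with e | e <;> omega⟩, SDE.within_mono _ ht h⟩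

/-- The strip diagram is symmetric. [folklore] -/
theorem cmk_stripDiagram_symm {i : ℤ} {x : Obs} {p q : Site 2} (h : (p, q) ∈ stripDiagram i x) : (q, p) ∈ stripDiagram i x := by
  rw [SDE.mem_stripDiagram_iff] at h ⊢
  obtain ⟨hp0, hq0, hq, hp, hr⟩ := h
  have e := cmk_cls_eq_of_mem hq
  refine ⟨hq0, hp0, by rw [e]; exact hp, ⟨Iff.rfl, hq.2⟩, ?_⟩
  rw [e]; exact hr.symm

/-- The strip diagram is transitive. [folklore] -/
theorem cmk_stripDiagram_trans {i : ℤ} {x : Obs} {p q r : Site 2} (h : (p, q) ∈ stripDiagram i x)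
    (h' : (q, r) ∈ stripDiagram i x) : (p, r) ∈ stripDiagram i x := by
  rw [SDE.mem_stripDiagram_iff] at h h' ⊢
  obtain ⟨hp0, -, hq, hp, hr⟩ := h
  obtain ⟨-, hr0, hr', -, hr''⟩ := h'
  have e := cmk_cls_eq_of_mem hq
  rw [e] at hr' hr''
  exact ⟨hp0, hr0, hr', hp, hr.trans hr''⟩

/-! ## Bichromatic faces do not matter -/

/-- Adjacency inside a vertex set does not depend on the flags of faces both of whose diagonals have an
endpoint outside the set. [folklore] -/
theorem cmk_adj_congr_of_bichromatic {A A' s : Set (Site 2)}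
    (hface : ∀ a b : ℤ, ((![a, b] : Site 2) ∈ A ↔ (![a, b] : Site 2) ∈ A') ∨
      (¬ ((![a, b] : Site 2) ∈ s ∧ (![a + 1, b + 1] : Site 2) ∈ s) ∧
       ¬ ((![a, b + 1] : Site 2) ∈ s ∧ (![a + 1, b] : Site 2) ∈ s)))
    {u v : Site 2} (hu : u ∈ s) (hv : v ∈ s) : (cellGraph A).Adj u v ↔ (cellGraph A').Adj u v := by
  rw [SDE.cellGraph_adj_iff, SDE.cellGraph_adj_iff]
  have hu' : (![u 0, u 1] : Site 2) = u := SDE.site2_eta u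
  have hv' : (![v 0, v 1] : Site 2) = v := SDE.site2_eta v
  have key := SDE.grid_adj_map (fun c d => (![c, d] : Site 2) ∈ A) (fun c d => (![c, d] : Site 2) ∈ A') 0 0 (u 0, u 1) (v 0, v 1)
    (fun c d hc hd => ?_)
  · simpa only [add_zero] using key
  simp only at hc hd
  rw [add_zero, add_zero]
  rcases hface c d with h | ⟨h1, h2⟩
  · exact h
  · exfalso
    rcases hc with ⟨rfl, hc⟩ | ⟨rfl, hc⟩ <;> rcases hd with ⟨rfl, hd⟩ | ⟨rfl, hd⟩
    · refine h1 ⟨by rw [hu']; exact hu, ?_⟩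
      rw [hc, hd, hv']; exact hv
    · refine h2 ⟨?_, ?_⟩
      · rw [hd, hu']; exact hu
      · rw [hc, hv']; exact hv
    · refine h2 ⟨?_, ?_⟩
      · rw [hd, hv']; exact hv
      · rw [hc, hu']; exact hu
    · refine h1 ⟨by rw [hv']; exact hv, ?_⟩
      rw [hc, hd, hu']; exact hu

/-- REACHABILITY INSIDE A SET DOES NOT DEPEND ON BICHROMATIC FACES. [folklore] -/
theorem cmk_reach_congr_of_bichromatic {A A' s : Set (Site 2)}
    (hface : ∀ a b : ℤ, ((![a, b] : Site 2) ∈ A ↔ (![a, b] : Site 2) ∈ A') ∨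
      (¬ ((![a, b] : Site 2) ∈ s ∧ (![a + 1, b + 1] : Site 2) ∈ s) ∧
       ¬ ((![a, b + 1] : Site 2) ∈ s ∧ (![a + 1, b] : Site 2) ∈ s)))
    (u v : Site 2) : (SDE.within (cellGraph A) s).Reachable u v ↔ (SDE.within (cellGraph A') s).Reachable u v :=
  ⟨SDE.within_mono_graph s fun _ _ ha hb hab => (cmk_adj_congr_of_bichromatic hface ha hb).1 hab,
   SDE.within_mono_graph s fun _ _ ha hb hab => (cmk_adj_congr_of_bichromatic (A := A') (A' := A) (s := s)
    (fun a b => (hface a b).imp Iff.symm id) ha hb).1 hab⟩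

/-! ## Row splitting and the excursion lemma -/

section Graph

variable {V : Type*}

/-- A path from row `≤ y` to row `≥ y` visits row `y` at a vertex joined to both its ends. [folklore] -/
theorem cmk_exists_row_split (G : SimpleGraph V) (row : V → ℤ) (hG : ∀ u v, G.Adj u v → row v ≤ row u + 1)
    {u v : V} (h : G.Reachable u v) (y : ℤ) (h1 : row u ≤ y) (h2 : y ≤ row v) :
    ∃ w, G.Reachable u w ∧ G.Reachable w v ∧ row w = y := by
  rw [SimpleGraph.reachable_iff_reflTransGen] at h
  revert h2
  induction h with
  | refl => intro h2; exact ⟨u, SimpleGraph.Reachable.refl _, SimpleGraph.Reachable.refl _, by omega⟩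
  | @tail b c hab hbc ih =>
    intro h2
    by_cases hy : y ≤ row b
    · obtain ⟨w, hw1, hw2, hw3⟩ := ih hy
      exact ⟨w, hw1, hw2.trans hbc.reachable, hw3⟩
    · have := hG b c hbc
      exact ⟨c, (SimpleGraph.reachable_iff_reflTransGen _ _).2 (hab.tail hbc), SimpleGraph.Reachable.refl _, by omega⟩

/-- The same, for a path descending from row `≥ y` to row `≤ y`. [folklore] -/
theorem cmk_exists_row_split' (G : SimpleGraph V) (row : V → ℤ) (hG : ∀ u v, G.Adj u v → row u ≤ row v + 1)
    {u v : V} (h : G.Reachable u v) (y : ℤ) (h1 : y ≤ row u) (h2 : row v ≤ y) :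
    ∃ w, G.Reachable u w ∧ G.Reachable w v ∧ row w = y := by
  obtain ⟨w, hw1, hw2, hw3⟩ := cmk_exists_row_split G (fun v => -row v) (fun u v huv => by have := hG u v huv; omega)
    h (-y) (by omega) (by omega)
  exact ⟨w, hw1, hw2, by omega⟩

/-- THE EXCURSION LEMMA (registered sub-goal `cmk_excursion`): in a graph whose edges change `row` by at
most one, a path inside `s` between two DISTINCT row-`c` vertices contains a sub-path from its start to
another row-`c` vertex of `s` staying inside the rows `≥ c` or inside the rows `≤ c`. [folklore] -/
theorem cmk_excursion : ∀ {V : Type*} (G : SimpleGraph V) (row : V → ℤ),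
    (∀ u v, G.Adj u v → row v ≤ row u + 1 ∧ row u ≤ row v + 1) → ∀ (s : Set V) (c : ℤ) (X X' : V),
    row X = c → row X' = c → X ≠ X' → (SDE.within G s).Reachable X X' →
    ∃ Z, Z ∈ s ∧ row Z = c ∧ Z ≠ X ∧
      ((SDE.within G (s ∩ {v | c ≤ row v})).Reachable X Z ∨ (SDE.within G (s ∩ {v | row v ≤ c})).Reachable X Z) := by
  intro V G row hG s c X X' hXc hX'c hne h
  -- the invariant along the walk
  suffices key : (∃ Z, Z ∈ s ∧ row Z = c ∧ Z ≠ X ∧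
      ((SDE.within G (s ∩ {v | c ≤ row v})).Reachable X Z ∨ (SDE.within G (s ∩ {v | row v ≤ c})).Reachable X Z)) ∨
      (c ≤ row X' ∧ (SDE.within G (s ∩ {v | c ≤ row v})).Reachable X X' ∧ (row X' = c → X' = X)) ∨
      (row X' ≤ c ∧ (SDE.within G (s ∩ {v | row v ≤ c})).Reachable X X' ∧ (row X' = c → X' = X)) by
    rcases key with h' | ⟨-, -, h'⟩ | ⟨-, -, h'⟩
    · exact h'
    · exact absurd (h' hX'c).symm hne
    · exact absurd (h' hX'c).symm hne
  clear hne hX'c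
  rw [SimpleGraph.reachable_iff_reflTransGen] at h
  induction h with
  | refl => exact Or.inr (Or.inl ⟨hXc.ge, SimpleGraph.Reachable.refl _, fun _ => rfl⟩)
  | @tail b b' _ hbb' ih =>
    obtain ⟨hadj, hb, hb'⟩ := hbb'
    obtain ⟨hr1, hr2⟩ := hG b b' hadj
    rcases ih with hfound | ⟨hcb, hXb, hbX⟩ | ⟨hcb, hXb, hbX⟩
    · exact Or.inl hfound
    · by_cases hcb' : c ≤ row b'
      · have hXb' : (SDE.within G (s ∩ {v | c ≤ row v})).Reachable X b' :=
          hXb.trans (SimpleGraph.Adj.reachable ⟨hadj, ⟨hb, hcb⟩, ⟨hb', hcb'⟩⟩)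
        by_cases hfnd : row b' = c ∧ b' ≠ X
        · exact Or.inl ⟨b', hb', hfnd.1, hfnd.2, Or.inl hXb'⟩
        · exact Or.inr (Or.inl ⟨hcb', hXb', fun e => by by_contra hne'; exact hfnd ⟨e, hne'⟩⟩)
      · have hrow : row b = c := by omega
        have hbX' : b = X := hbX hrow
        subst hbX'
        exact Or.inr (Or.inr ⟨by omega, SimpleGraph.Adj.reachable ⟨hadj, ⟨hb, hrow.le⟩, ⟨hb', by show row b' ≤ c; omega⟩⟩,
          fun e => by omega⟩)
    · by_cases hcb' : row b' ≤ c
      · have hXb' : (SDE.within G (s ∩ {v | row v ≤ c})).Reachable X b' :=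
          hXb.trans (SimpleGraph.Adj.reachable ⟨hadj, ⟨hb, hcb⟩, ⟨hb', hcb'⟩⟩)
        by_cases hfnd : row b' = c ∧ b' ≠ X
        · exact Or.inl ⟨b', hb', hfnd.1, hfnd.2, Or.inr hXb'⟩
        · exact Or.inr (Or.inr ⟨hcb', hXb', fun e => by by_contra hne'; exact hfnd ⟨e, hne'⟩⟩)
      · have hrow : row b = c := by omega
        have hbX' : b = X := hbX hrow
        subst hbX'
        exact Or.inr (Or.inl ⟨by omega, SimpleGraph.Adj.reachable ⟨hadj, ⟨hb, hrow.ge⟩, ⟨hb', by show c ≤ row b'; omega⟩⟩,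
          fun e => by omega⟩)

end Graph

end Summit.CriticalPhenomena.CardyFormulaZ2.Theorems.IKLinearTransport.PinnedDiagramExchange
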